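import Summits.PneNP.PneNP.Theorems.ChebyshevTracialDesignShellOperatorForm
import Literature.Combinatorics.Optimization.ShellLawSmoothing
import HarnessLib

/-!
# Cell pnp-psdrank, route `ChebyshevTracialDesign`: PER-MATCHING PRICING OF A BLOCK STATISTIC `ψ(|U ∩ H|)` BY AN EXACT DESIGN,
# modulo the `x`-smoothness of the deleted shell laws — the first NON-JUNTA per-matching estimate (crux `TracialDecayExp20`, stmt-PneNP-19878)

Brick 117 (prover g21; MEMO-23 §5 (1) / §7 (S_k), LIT-44 §5 (k1)(k2)(c3), LIT-45). Fix an exact design `(n,t,T,D,B_v,C,w)`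
(`IsExactDesign`), a perfect matching `M` (partner involution `π`), a block `H ⊆ [n]` and a profile `ψ : ℤ → ℝ`
with `|ψ| ≤ G` on `[0,t]`; the cut statistic is `g(U) = ψ(|U ∩ H|)` (an `H`-SYMMETRIC MASK — a threshold, a cap,
a slab indicator of `|U ∩ H|`: NOT a junta when `|H| ≍ n`). Its shell profile at `M` is `φ_M(c) = E_{Shell_c(M)}[g] =
Σ_x ψ(x)·law(t,c;x)` (Literature `shellAvg_eq_sum_mul_shellLaw`), and by Literature `ShellLawSmoothing`
(`sum_abs_nab2_iter_fwdDiff_iter_le`, the iterated form of lit's `levelStep_shellLaw`) its level differences obey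
`|Δ^k_{(2)} φ_M(c)| ≤ G·ρ^k·X_k` whenever every `k`-fold two-edge-deleted sub-matching `S′` (`|S′| = n − 4k`) has
`Σ_{x=0}^{t} |∇^{2k} law_{S′}(t−2k, c; x)| ≤ X_k` — the `x`-SMOOTHNESS NUMBERS of the deleted shell laws
(`ρ = m/(4(m−2))`, `m = n − 4(D+1)`: `pairs_le_rho`). Feeding this into the exact-design remainder
(Literature `IsExactDesign.abs_levelSum_add_le_of_fwdDiff_odd`) and the Newton series of the virtual value
(`DesignRemainder.newtonPolyOdd_eq_sum` + brick 111's `chooseXOdd_eval_zero`, `designValue_eq_shellAvg`):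

* §1 `fwdDiff_iter_one_odd` (`Δ^k_{(1)}[j ↦ φ(2j+1)](j) = Δ^k_{(2)}φ(2j+1)`), **`abs_fwdDiff_iter_shellProfile_le`**:
  `|Δ^k_{(2)} φ_M(c)| ≤ G·ρ^k·X_k` for odd `c` with `c + 2k ≤ t`, `t + c + 2k ≤ n`.
* §2 **`abs_designValue_blockStat_add_newton_le`**: `| |PM|·Σ_U W(U,M)ψ(|U∩H|) + N^{odd}_D φ_M(0) | ≤ B_v·C((T−1)/2,D+1)·G·ρ^{D+1}·X_{D+1}`;
  **`newtonPolyOdd_shellProfile_le`**: `−N^{odd}_D φ_M(0) ≤ −E_{Shell_1(M)}[g] + G·Σ_{k=1}^{D} (C(2k,k)/4^k)·ρ^k·X_k`;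
  **`designValue_blockStat_le`** (THE PRICING): `|PM|·Σ_U W(U,M)·ψ(|U∩H|) ≤ −E_{Shell_1(M)}[ψ(|U∩H|)]
  + G·Σ_{k=1}^{D} (C(2k,k)/4^k)·ρ^k·X_k + B_v·C((T−1)/2,D+1)·G·ρ^{D+1}·X_{D+1}` — for a NONNEGATIVE mask the design value at
  `M` is at most the smoothness budget (the tight-shell term `−E_{Shell_1}[g] ≤ 0` helps).
READING (MEMO-23 §3/§7, LIT-44 §5): with the x-smoothness `X_k ≲ (Ck/n)^k` of shell laws (Literature
`PoissonBinomialDifferences.hypergeometric_absCoeffSum_le` on the hypergeometric components of lit's mixture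
`ShellLawLevelStep` §9–§10, outside the aligned-`M` exceptional set) the remainder is `≈ 20·(2√n)^{D+1}/(D+1)!·(C(D+1)/(4n))^{D+1}`,
super-polynomially small, and the Newton-series correction is `O(G/n)`: H-symmetric masks are priced per matching at
`−E_{Shell_1(M)}[g] + O(G/n)`. WHAT THIS FILE DOES NOT DO: bound the `X_k` (that is the mixture∘hypergeometric glue, next brick);
treat tilted masks `ψ(|U∩H|)·C_v²` (pinning lemma, LIT-44 §7); prove or refute `TracialDecayExp20`; say anything on psd rank or P vs NP.
[cite: Rothvoss2017, §2 (PDF p. 6)] [cite: Agarwal2000DifferenceEquations, Thm. 1.8.5 (1.8.6), Remark 1.8.1 (1.8.8)]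
[cite: RollinRoss2010, §3 (Lemma 3.1)] [cite: GriblingDelaatLaurent2019, §5]
Stature: support/instrument (kernel lane, no defs, axioms standard). Supports stmt-PneNP-19878.
-/

set_option linter.dupNamespace false -- `Summit.PneNP.PneNP.…`: summit = sub-problem (D-0017)

noncomputable section

namespace Summit.PneNP.PneNP.Theorems.ChebyshevTracialDesignBlockStatisticPricing

open Finset Polynomial Literature.Barriers.PneNP Literature.Combinatorics.Optimization
open Literature.Combinatorics.Optimization.ShellStep
open Summit.PneNP.PneNP.Theorems.ChebyshevTracialDesignShellOperatorForm (designValue_eq_shellAvg chooseXOdd_eval_zero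
  shell_partner_nonempty)

variable {n : ℕ}

/-! ### §1 Level differences of the shell profile of a block statistic -/

/-- Step-`1` differences of the odd-level subsequence are step-`2` differences of the profile:
`Δ^k_{(1)}[j ↦ φ(2j+1)](j) = Δ^k_{(2)}[φ](2j+1)`. [cite: Agarwal2000DifferenceEquations, Thm. 1.8.5 (1.8.6)] -/
theorem fwdDiff_iter_one_odd (φ : ℕ → ℝ) (k j : ℕ) :
    ((fwdDiff (1 : ℕ))^[k] (fun j : ℕ => φ (2 * j + 1))) j = ((fwdDiff (2 : ℕ))^[k] φ) (2 * j + 1) := by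
  rw [fwdDiff_iter_eq_sum_shift, fwdDiff_iter_eq_sum_shift]
  refine sum_congr rfl fun i _ => ?_
  simp only [smul_eq_mul, mul_one]
  ring_nf

/-- The `ρ` of the cell: `ρ = m/(4(m−2))` with `m = n − 4(D+1)` (so `ρ → 1/4`). The deletion-pair hypothesis of
Literature `sum_abs_nab2_iter_fwdDiff_iter_le` holds with it for every `π`-stable `S′` of size `≥ m ≥ 3`.
[cite: Rothvoss2017, §2 (PDF p. 6)] -/
theorem pairs_hyp {π : Fin n → Fin n} (hπ : ∀ v, π (π v) = v) (H : Finset (Fin n)) {m : ℕ} (hm : 3 ≤ m)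
    (S' : Finset (Fin n)) (hS' : ∀ v ∈ S', π v ∈ S') (hmS' : m ≤ S'.card) :
    ((vAA π S' H).card : ℝ) * (vDD π S' H).card + ((vBH π S' H).card : ℝ) * (vBN π S' H).card ≤
      ((m : ℝ) / (4 * ((m : ℝ) - 2))) * ((S'.card : ℝ) * ((S'.card : ℝ) - 2)) :=
  pairs_le_rho hπ hS' H hm hmS'

/-- `ρ = m/(4(m−2)) ≥ 0` for `m ≥ 3`. [cite: Rothvoss2017, §2 (PDF p. 6)] -/
theorem rho_nonneg {m : ℕ} (hm : 3 ≤ m) : (0 : ℝ) ≤ (m : ℝ) / (4 * ((m : ℝ) - 2)) := by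
  have : (3 : ℝ) ≤ m := by exact_mod_cast hm
  exact div_nonneg (by linarith) (by linarith)

/-- **Level differences of a block-statistic profile are controlled by the `x`-smoothness of the deleted shell
laws**: for a perfect matching `M` (partner map `π`), a block `H`, `|ψ| ≤ G` on `[0,t]`, an odd cut size `t = t′ + 2k`, an
odd level `c` with `c + 2k ≤ t` and `t + c + 2k ≤ n`, and `m ≥ 3` with `m + 4k ≤ n`: if every `π`-stable `S′` with
`|S′| + 4k = n` has `Σ_{x=0}^{t} |(∇²)^k law_{S′}(t′,·)(c)(x)| ≤ X`, then
`|Δ^k_{(2)}[c ↦ E_{Shell_c(M)}[ψ(|U∩H|)]](c)| ≤ G·(m/(4(m−2)))^k·X`.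
[cite: Rothvoss2017, §2 (PDF p. 6)] [cite: RollinRoss2010, §3 (Lemma 3.1)] -/
theorem abs_fwdDiff_iter_shellProfile_le (M : PMatch n) (H : Finset (Fin n)) (ψ : ℤ → ℝ) {G : ℝ} (hG0 : 0 ≤ G)
    {t' k c m : ℕ} (hG : ∀ x ∈ Icc (0 : ℤ) ((t' + 2 * k : ℕ) : ℤ), |ψ x| ≤ G) (ht : Odd (t' + 2 * k)) (hc : Odd c)
    (hct : c + 2 * k ≤ t' + 2 * k) (hn : t' + 2 * k + (c + 2 * k) ≤ n) (hm : 3 ≤ m) (hmn : m + 4 * k ≤ n)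
    {X : ℝ} (hX0 : 0 ≤ X)
    (hX : ∀ S' : Finset (Fin n), (∀ v ∈ S', M.2.partner v ∈ S') → S'.card + 4 * k = n →
      ∑ x ∈ Icc (0 : ℤ) ((t' + 2 * k : ℕ) : ℤ),
        |nab2^[k] (fun c' x => shellLaw M.2.partner S' H t' c' x : Profile) c x| ≤ X) :
    |((fwdDiff (2 : ℕ))^[k] (fun c => (∑ U ∈ shell M.2.partner (t' + 2 * k) c, ψ ((U ∩ H).card : ℤ)) /
        ((shell M.2.partner (t' + 2 * k) c).card : ℝ))) c| ≤
      G * (((m : ℝ) / (4 * ((m : ℝ) - 2))) ^ k * X) := by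
  set π := M.2.partner with hπdef
  have hπ : ∀ v, π (π v) = v := partner_partner M
  have hπ' : ∀ v, π v ≠ v := partner_ne M
  refine (abs_fwdDiff_iter_shellAvg_le H (t' + 2 * k) k c ψ hG).trans (mul_le_mul_of_nonneg_left ?_ hG0)
  -- the iterated `ℓ¹` bound on the full ground set `univ`
  have hρ0 : (0 : ℝ) ≤ (m : ℝ) / (4 * ((m : ℝ) - 2)) := rho_nonneg hm
  have hne : (shellIn π univ (t' + 2 * k) (c + 2 * k)).Nonempty := by
    rw [shellIn_univ]
    exact shell_partner_nonempty M ht (by obtain ⟨i, hi⟩ := hc; exact ⟨i + k, by omega⟩) hct hn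
  have h := sum_abs_nab2_iter_fwdDiff_iter_le hπ hπ' H t' (Icc (0 : ℤ) ((t' + 2 * k : ℕ) : ℤ)) hρ0 hX0 k 0
    (S := univ) (fun v _ => mem_univ _) c hne
    (fun S' _ hS' hlt => pairs_hyp hπ H hm S' hS' (by rw [card_univ, Fintype.card_fin] at hlt; omega))
    (fun S' _ hS' heq => by
      rw [zero_add]
      exact hX S' hS' (by rw [card_univ, Fintype.card_fin] at heq; omega))
  simpa using h

/-! ### §2 The per-matching pricing theorem -/

/-- **Design remainder for a block statistic, per matching.** For an exact design `(n,t,T,D,B_v,C,w)`, a matching `M`,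
a block `H`, `|ψ| ≤ G` on `[0,t]`, `t = t′ + 2(D+1)`, `m = n − 4(D+1) ≥ 3` (automatic sizes aside), and the
`x`-smoothness number `X` of the `(D+1)`-fold deleted shell laws at all odd base levels `c ≤ T`:
`| Σ_U W(U,M)·ψ(|U∩H|) + |PM|⁻¹·N^{odd}_D φ_M(0) | ≤ |PM|⁻¹·B_v·C((T−1)/2, D+1)·G·ρ^{D+1}·X`.
[cite: Agarwal2000DifferenceEquations, Remark 1.8.1 (1.8.8)] [cite: Rothvoss2017, §2 (PDF p. 6)] -/
theorem abs_designValue_blockStat_add_newton_le {t' T D : ℕ} {Bv : ℝ} {C : Finset ℕ} {w : ℕ → ℝ}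
    (hdes : IsExactDesign n (t' + 2 * (D + 1)) T D Bv C w) (M : PMatch n) (H : Finset (Fin n)) (ψ : ℤ → ℝ)
    {G : ℝ} (hG0 : 0 ≤ G) (hG : ∀ x ∈ Icc (0 : ℤ) ((t' + 2 * (D + 1) : ℕ) : ℤ), |ψ x| ≤ G)
    {m : ℕ} (hm : 3 ≤ m) (hmn : m + 4 * (D + 1) ≤ n) {X : ℝ} (hX0 : 0 ≤ X)
    (hX : ∀ c : ℕ, Odd c → c + 2 * (D + 1) ≤ T → ∀ S' : Finset (Fin n), (∀ v ∈ S', M.2.partner v ∈ S') →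
      S'.card + 4 * (D + 1) = n →
      ∑ x ∈ Icc (0 : ℤ) ((t' + 2 * (D + 1) : ℕ) : ℤ),
        |nab2^[D + 1] (fun c' x => shellLaw M.2.partner S' H t' c' x : Profile) c x| ≤ X) :
    |∑ U : OddSet n, levelWeight n (t' + 2 * (D + 1)) C w U M * ψ ((U.1 ∩ H).card : ℤ) +
        (Fintype.card (PMatch n) : ℝ)⁻¹ * (DesignRemainder.newtonPolyOdd D
          (fun c => (∑ U' ∈ shell M.2.partner (t' + 2 * (D + 1)) c, ψ ((U' ∩ H).card : ℤ)) /
            ((shell M.2.partner (t' + 2 * (D + 1)) c).card : ℝ))).eval 0| ≤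
      (Fintype.card (PMatch n) : ℝ)⁻¹ *
        (Bv * ((((T - 1) / 2).choose (D + 1) : ℕ) : ℝ) * (G * (((m : ℝ) / (4 * ((m : ℝ) - 2))) ^ (D + 1) * X))) := by
  set t := t' + 2 * (D + 1) with htdef
  have ht : Odd t := hdes.1
  have h2t : 2 * t + 2 ≤ n := hdes.2.1
  have hTt : T ≤ t := hdes.2.2.1
  set φ : ℕ → ℝ := fun c => (∑ U' ∈ shell M.2.partner t c, ψ ((U' ∩ H).card : ℤ)) /
    ((shell M.2.partner t c).card : ℝ) with hφ
  -- the remainder estimate of the exact design, fed with §1 at `k = D + 1`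
  have hK : ∀ j : ℕ, 2 * (j + D + 1) + 1 ≤ T →
      |((fwdDiff (1 : ℕ))^[D + 1] (fun j => φ (2 * j + 1))) j| ≤
        G * (((m : ℝ) / (4 * ((m : ℝ) - 2))) ^ (D + 1) * X) := by
    intro j hj
    rw [fwdDiff_iter_one_odd]
    refine abs_fwdDiff_iter_shellProfile_le M H ψ hG0 hG ht ⟨j, rfl⟩ (by omega) (by omega) hm hmn hX0
      (hX (2 * j + 1) ⟨j, rfl⟩ (by omega))
  have hρ0 : (0 : ℝ) ≤ (m : ℝ) / (4 * ((m : ℝ) - 2)) := rho_nonneg hm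
  have hrem := hdes.abs_levelSum_add_le_of_fwdDiff_odd φ (by positivity) hK
  -- `Σ_U W g = |PM|⁻¹ Σ_c w_c φ(c)`
  rw [designValue_eq_shellAvg t ht C w M (fun U => ψ ((U ∩ H).card : ℤ)), ← mul_add, abs_mul,
    abs_of_nonneg (by positivity)]
  exact mul_le_mul_of_nonneg_left hrem (by positivity)

/-- **The virtual value of a block statistic**: `−N^{odd}_D φ_M(0) ≤ −E_{Shell_1(M)}[g] + G·Σ_{k=1}^{D} (C(2k,k)/4^k)·ρ^k·X_k`
(Newton series `N^{odd}_D φ(0) = Σ_{k≤D} (−1)^k (C(2k,k)/4^k) Δ^kψ(0)`, `ψ(j) = φ(2j+1)`; the `k = 0` term is the tight-shell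
average, the others are bounded by §1). [cite: Agarwal2000DifferenceEquations, Thm. 1.8.5 (1.8.6)] [cite: Rothvoss2017, §2 (PDF p. 6)] -/
theorem newtonPolyOdd_shellProfile_le {t' D : ℕ} (M : PMatch n) (H : Finset (Fin n)) (ψ : ℤ → ℝ)
    (ht : Odd (t' + 2 * (D + 1))) (hn : 2 * (t' + 2 * (D + 1)) + 2 ≤ n)
    {G : ℝ} (hG0 : 0 ≤ G) (hG : ∀ x ∈ Icc (0 : ℤ) ((t' + 2 * (D + 1) : ℕ) : ℤ), |ψ x| ≤ G)
    {m : ℕ} (hm : 3 ≤ m) (hmn : m + 4 * (D + 1) ≤ n) (X : ℕ → ℝ) (hX0 : ∀ k, 0 ≤ X k)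
    (hX : ∀ k, 1 ≤ k → k ≤ D → ∀ S' : Finset (Fin n), (∀ v ∈ S', M.2.partner v ∈ S') → S'.card + 4 * k = n →
      ∑ x ∈ Icc (0 : ℤ) ((t' + 2 * (D + 1) : ℕ) : ℤ),
        |nab2^[k] (fun c' x => shellLaw M.2.partner S' H (t' + 2 * (D + 1) - 2 * k) c' x : Profile) 1 x| ≤ X k) :
    -(DesignRemainder.newtonPolyOdd D
        (fun c => (∑ U' ∈ shell M.2.partner (t' + 2 * (D + 1)) c, ψ ((U' ∩ H).card : ℤ)) /
          ((shell M.2.partner (t' + 2 * (D + 1)) c).card : ℝ))).eval 0 ≤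
      -((∑ U' ∈ shell M.2.partner (t' + 2 * (D + 1)) 1, ψ ((U' ∩ H).card : ℤ)) /
          ((shell M.2.partner (t' + 2 * (D + 1)) 1).card : ℝ)) +
        G * ∑ k ∈ Icc 1 D, (((2 * k).choose k : ℕ) : ℝ) / (4 : ℝ) ^ k * ((((m : ℝ) / (4 * ((m : ℝ) - 2))) ^ k) * X k) := by
  set t := t' + 2 * (D + 1) with htdef
  set φ : ℕ → ℝ := fun c => (∑ U' ∈ shell M.2.partner t c, ψ ((U' ∩ H).card : ℤ)) /
    ((shell M.2.partner t c).card : ℝ) with hφ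
  rw [DesignRemainder.newtonPolyOdd_eq_sum, eval_finsetSum]
  simp only [eval_mul, eval_C, chooseXOdd_eval_zero]
  -- split off `k = 0`
  rw [show range (D + 1) = insert 0 (Icc 1 D) by
      ext k; simp only [mem_range, mem_insert, mem_Icc]; omega,
    sum_insert (by simp), Function.iterate_zero, id_eq, pow_zero, pow_zero, Nat.mul_zero, Nat.choose_zero_right,
    Nat.cast_one, one_mul, div_one, mul_one, neg_add, mul_sum]
  simp only [zero_add]
  refine add_le_add le_rfl ?_
  rw [← sum_neg_distrib]
  refine sum_le_sum fun k hk => ?_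
  obtain ⟨hk1, hkD⟩ := mem_Icc.1 hk
  -- `|Δ^k ψ(0)| ≤ G ρ^k X_k` by §1 at level `c = 1`, cut `t = (t − 2k) + 2k`
  have hsplit : t' + 2 * (D + 1) = (t' + 2 * (D + 1) - 2 * k) + 2 * k := by omega
  have hbd : |((fwdDiff (1 : ℕ))^[k] (fun j => φ (2 * j + 1))) 0| ≤
      G * (((m : ℝ) / (4 * ((m : ℝ) - 2))) ^ k * X k) := by
    rw [fwdDiff_iter_one_odd, hφ, htdef]
    rw [hsplit]
    refine abs_fwdDiff_iter_shellProfile_le M H ψ hG0 (by rw [← hsplit]; exact hG) (by rw [← hsplit]; exact ht)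
      ⟨0, rfl⟩ (by omega) (by omega) hm (by omega) (hX0 k) ?_
    intro S' hS' hcard
    have := hX k hk1 hkD S' hS' hcard
    rwa [← hsplit]
  have habs := (abs_le.1 hbd)
  have hcoef : 0 ≤ (((2 * k).choose k : ℕ) : ℝ) / (4 : ℝ) ^ k := by positivity
  calc -(((fwdDiff (1 : ℕ))^[k] (fun j => φ (2 * j + 1))) 0 * ((-1 : ℝ) ^ k * (((2 * k).choose k : ℕ) : ℝ) / (4 : ℝ) ^ k))
      = (-((-1 : ℝ) ^ k * ((fwdDiff (1 : ℕ))^[k] (fun j => φ (2 * j + 1))) 0)) * ((((2 * k).choose k : ℕ) : ℝ) / (4 : ℝ) ^ k) := by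
        ring
    _ ≤ (G * (((m : ℝ) / (4 * ((m : ℝ) - 2))) ^ k * X k)) * ((((2 * k).choose k : ℕ) : ℝ) / (4 : ℝ) ^ k) := by
        refine mul_le_mul_of_nonneg_right ?_ hcoef
        rcases neg_one_pow_eq_or ℝ k with h1 | h1 <;> rw [h1] <;> linarith [habs.1, habs.2]
    _ = G * ((((2 * k).choose k : ℕ) : ℝ) / (4 : ℝ) ^ k * ((((m : ℝ) / (4 * ((m : ℝ) - 2))) ^ k) * X k)) := by ring

/-- **PER-MATCHING PRICING OF A BLOCK STATISTIC (brick 117).** For an exact design `(n,t,T,D,B_v,C,w)` with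
`t = t′ + 2(D+1)`, a perfect matching `M`, a block `H`, a profile `|ψ| ≤ G` on `[0,t]`, `m ≥ 3` with `m + 4(D+1) ≤ n`,
and `x`-smoothness numbers `X_k ≥ 0` of the `k`-fold two-edge-deleted shell laws (`1 ≤ k ≤ D+1`, all `π_M`-stable `S′` with
`|S′| = n − 4k`, base level `1` for `k ≤ D` and all odd base levels `c ≤ T − 2(D+1)` for `k = D+1`):
`|PM|·Σ_U W(U,M)·ψ(|U∩H|) ≤ −E_{Shell_1(M)}[ψ(|U∩H|)] + G·Σ_{k=1}^{D} (C(2k,k)/4^k)·ρ^k·X_k + B_v·C((T−1)/2,D+1)·G·ρ^{D+1}·X_{D+1}`,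
`ρ = m/(4(m−2))`. [cite: Rothvoss2017, §2 (PDF p. 6)] [cite: Agarwal2000DifferenceEquations, Remark 1.8.1 (1.8.8)]
[cite: GriblingDelaatLaurent2019, §5] -/
theorem designValue_blockStat_le {t' T D : ℕ} {Bv : ℝ} {C : Finset ℕ} {w : ℕ → ℝ}
    (hdes : IsExactDesign n (t' + 2 * (D + 1)) T D Bv C w) (M : PMatch n) (H : Finset (Fin n)) (ψ : ℤ → ℝ)
    {G : ℝ} (hG0 : 0 ≤ G) (hG : ∀ x ∈ Icc (0 : ℤ) ((t' + 2 * (D + 1) : ℕ) : ℤ), |ψ x| ≤ G)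
    {m : ℕ} (hm : 3 ≤ m) (hmn : m + 4 * (D + 1) ≤ n) (X : ℕ → ℝ) (hX0 : ∀ k, 0 ≤ X k)
    (hX : ∀ k, 1 ≤ k → k ≤ D → ∀ S' : Finset (Fin n), (∀ v ∈ S', M.2.partner v ∈ S') → S'.card + 4 * k = n →
      ∑ x ∈ Icc (0 : ℤ) ((t' + 2 * (D + 1) : ℕ) : ℤ),
        |nab2^[k] (fun c' x => shellLaw M.2.partner S' H (t' + 2 * (D + 1) - 2 * k) c' x : Profile) 1 x| ≤ X k)
    (hXtop : ∀ c : ℕ, Odd c → c + 2 * (D + 1) ≤ T → ∀ S' : Finset (Fin n), (∀ v ∈ S', M.2.partner v ∈ S') →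
      S'.card + 4 * (D + 1) = n →
      ∑ x ∈ Icc (0 : ℤ) ((t' + 2 * (D + 1) : ℕ) : ℤ),
        |nab2^[D + 1] (fun c' x => shellLaw M.2.partner S' H t' c' x : Profile) c x| ≤ X (D + 1)) :
    (Fintype.card (PMatch n) : ℝ) * ∑ U : OddSet n, levelWeight n (t' + 2 * (D + 1)) C w U M * ψ ((U.1 ∩ H).card : ℤ) ≤
      -((∑ U' ∈ shell M.2.partner (t' + 2 * (D + 1)) 1, ψ ((U' ∩ H).card : ℤ)) /
          ((shell M.2.partner (t' + 2 * (D + 1)) 1).card : ℝ)) +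
        G * ∑ k ∈ Icc 1 D, (((2 * k).choose k : ℕ) : ℝ) / (4 : ℝ) ^ k * ((((m : ℝ) / (4 * ((m : ℝ) - 2))) ^ k) * X k) +
        Bv * ((((T - 1) / 2).choose (D + 1) : ℕ) : ℝ) * (G * (((m : ℝ) / (4 * ((m : ℝ) - 2))) ^ (D + 1) * X (D + 1))) := by
  have hPM : (0 : ℝ) < (Fintype.card (PMatch n) : ℝ) := by
    have : 0 < Fintype.card (PMatch n) := Fintype.card_pos_iff.2 ⟨M⟩
    exact_mod_cast this
  have h1 := abs_designValue_blockStat_add_newton_le hdes M H ψ hG0 hG hm hmn (hX0 (D + 1)) hXtop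
  have h2 := newtonPolyOdd_shellProfile_le M H ψ hdes.1 hdes.2.1 hG0 hG hm hmn X hX0 hX
  have h1' := (abs_le.1 h1).2
  -- multiply through by `|PM|`
  have key : (Fintype.card (PMatch n) : ℝ) *
      (∑ U : OddSet n, levelWeight n (t' + 2 * (D + 1)) C w U M * ψ ((U.1 ∩ H).card : ℤ)) ≤
      -(DesignRemainder.newtonPolyOdd D
        (fun c => (∑ U' ∈ shell M.2.partner (t' + 2 * (D + 1)) c, ψ ((U' ∩ H).card : ℤ)) /
          ((shell M.2.partner (t' + 2 * (D + 1)) c).card : ℝ))).eval 0 +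
        Bv * ((((T - 1) / 2).choose (D + 1) : ℕ) : ℝ) * (G * (((m : ℝ) / (4 * ((m : ℝ) - 2))) ^ (D + 1) * X (D + 1))) := by
    have := mul_le_mul_of_nonneg_left h1' hPM.le
    rw [mul_add, ← mul_assoc, mul_inv_cancel₀ hPM.ne', one_mul, ← mul_assoc, mul_inv_cancel₀ hPM.ne', one_mul] at this
    linarith
  linarith

end Summit.PneNP.PneNP.Theorems.ChebyshevTracialDesignBlockStatisticPricing

end
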